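import Literature.Algebra.EuclideanLattices.DualGridSolverProgram
import Literature.Algebra.EuclideanLattices.IntegerMatrixInverseMachine
import Literature.Computability.Complexity.CodeFPLists
import HarnessLib

/-!
# The `IncGDD` solver of MR07 Thm. 5.9 on integer lattices is typed polynomial time

Topic `Algebra/EuclideanLattices` (family `pqc`). Machine layer of the solver `solRun` of
`DualGridSolverProgram.lean`: a `CodeFP` certificate for the map
`(instance tuple, coins) ↦ solRun P orun ocb n U V tw td rn rd coins` on the wire format
`IncGDDInst.tupleE` of `MRLemma510Function.lean`, against an `SIS` oracle `orun` that is itself typed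
polynomial time on `(query, coins)`, with the solver's constants computed from the unary dimension.
Everything is assembled from the tree's `CodeFP` algebra (`CodeFP.lean`, `CodeFPArith.lean`,
`CodeFPLists.lean`, `CodeFPBudgets.lean`), Cohen's integral inverse on codes
(`IntegerMatrixInverseMachine.lean`), the pseudo-Gaussian sampler on codes
(`PeikertSamplerVecMachine.lean`) and the canonical answer decoder (`SISOddPartMachine.lean`).

* list algebra on codes: `transposeL_codeFP`, `addL_codeFP`, `smulL_codeFP`, `negL_codeFP`,
  `edivL_codeFP`, `mulVecL_codeFP`, `colCombL_codeFP`;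
* the attempt programs of `DualGridProgram.lean` on the code `attE` of `AttData`:
  `FvecL_codeFP`, …, `uVecL_codeFP`;
* generic bricks restated to keep the import closure small (`unMulU_codeFP`, `unPolyU_codeFP`,
  `natSizeU'_codeFP`, as in `HidingProgramMachine.lean`), `unOfNatLe`, `natLog2_codeFP`, `intSign_codeFP`,
  `intEMod_codeFP`;
* the solver's input `SolIn`/`sinE` (= `pairE IncGDDInst.tupleE strE`), its constants as functions of the
  dimension with their machines (`SolFuns`, `SolFuns.P`), accessors `s_*`, the guess (`s_guess`, `s_α`),
  the data of the scaled instance (`s_Brows`, `s_c`, `s_Dg`, `s_Gcols`, `s_Srows`, `s_TSrows`, `s_N`,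
  `s_ellU`, `s_att`), the width (`s_X`, `s_e`, `s_eU`);
* the pseudo-Gaussian record of `std mₚ e` (`rOfU_codeFP`, `kOfU_codeFP`, `JOfU_codeFP`,
  `stdCtx_codeFP`, `stdCoinLen_codeFP`), the samples and boxes (`s_Xall`, `windows_codeFP`, `s_Xs`,
  `boxes_codeFP`, `s_κs`), the shifts `s_Tsh`/`s_Ks`, the query (`valRows_codeFP`, `queryStr_codeFP`,
  `s_qs`), the answer decoder `readAns_codeFP`, `answerRow_codeFP`, and **`solRun_codeFP`**.

## References

* S. Arora, B. Barak, *Computational Complexity: A Modern Approach*, CUP 2009, §1.3 (composition of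
  polynomial-time string functions) [AroraBarak2009].
* D. Micciancio, O. Regev, *Worst-case to average-case reductions based on Gaussian measures*,
  SIAM J. Comput. 37 (2007) 267–302, Thm. 5.9 ("a polynomial-time oracle algorithm").
-/

noncomputable section

namespace Literature.Algebra.EuclideanLattices

open GSInverse Literature.Computability.Complexity Literature.Computability.Complexity.CodeFP
  Literature.Computability.Cryptography Literature.Computability.QuantumComplexity Literature.Probability.Distributions

namespace DualGrid

/-! ### List algebra on codes -/

section ListAlgebra

/-- Reading entry `t` of every row: `(t, rows) ↦ [r[t]]ᵣ`. [folklore] -/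
theorem colAt_codeFP : CodeFP (pairE natE rowsE) (rawE intE) (fun p => p.2.map fun r => r.getD p.1 0) := by
  have hg := (rawGetOr intE).comp ((snd natE (rawE intE)).pair ((fst natE (rawE intE)).pair (const (pairE natE (rawE intE)) (0 : ℤ))))
  have h := map (σ := ℕ) (α := List ℤ) (β := ℤ) (eσ := natE) (eα := rawE intE) (eβ := intE) hg
  exact h.congr fun p => rfl

/-- **Transpose**: `(1ᵈ, rows) ↦ transposeL d rows`. [folklore] -/
theorem transposeL_codeFP : CodeFP (pairE unE rowsE) rowsE (fun p => transposeL p.1 p.2) := by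
  have hg := colAt_codeFP.comp ((snd rowsE natE).pair (fst rowsE natE))
  have h := map (σ := List (List ℤ)) (α := ℕ) (β := List ℤ) (eσ := rowsE) (eα := natE) (eβ := rawE intE) hg
  have h2 := h.comp ((snd unE rowsE).pair (urange.comp (fst unE rowsE)))
  exact h2.congr fun p => rfl

/-- **Sum of two vectors** (`zipWith`). [folklore] -/
theorem addL_codeFP : CodeFP (pairE (rawE intE) (rawE intE)) (rawE intE) (fun p => addL p.1 p.2) := by
  have hg := intAdd.comp ((snd unitE (pairE intE intE)).fst'.pair (snd unitE (pairE intE intE)).snd')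
  have hz := zipWith (σ := Unit) (α := ℤ) (β := ℤ) (γ := ℤ) (eσ := unitE) (eα := intE) (eβ := intE) (eγ := intE) hg
  have h2 := hz.comp ((const (pairE (rawE intE) (rawE intE)) ()).pair (CodeFP.id (pairE (rawE intE) (rawE intE))))
  exact h2.congr fun p => rfl

/-- **Scalar multiple.** [folklore] -/
theorem smulL_codeFP : CodeFP (pairE intE (rawE intE)) (rawE intE) (fun p => smulL p.1 p.2) := by
  have h := map (σ := ℤ) (α := ℤ) (β := ℤ) (eσ := intE) (eα := intE) (eβ := intE) intMul
  exact h.congr fun p => rfl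

/-- **Negation.** [folklore] -/
theorem negL_codeFP : CodeFP (rawE intE) (rawE intE) negL := by
  have h := map₀ (eα := intE) (eβ := intE) intNeg
  exact h.congr fun p => rfl

/-- **Coordinatewise integer division** `(v, d) ↦ [vᵢ / d]`. [folklore] -/
theorem edivL_codeFP : CodeFP (pairE (rawE intE) intE) (rawE intE) (fun p => edivL p.1 p.2) := by
  have hg := intEDiv.comp ((snd intE intE).pair (fst intE intE))
  have h := map (σ := ℤ) (α := ℤ) (β := ℤ) (eσ := intE) (eα := intE) (eβ := intE) hg
  have h2 := h.comp ((snd (rawE intE) intE).pair (fst (rawE intE) intE))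
  exact h2.congr fun p => rfl

/-- **Rows times vector.** [folklore] -/
theorem mulVecL_codeFP : CodeFP (pairE rowsE (rawE intE)) (rawE intE) (fun p => mulVecL p.1 p.2) := by
  have hg := dotZ_codeFP.comp ((snd (rawE intE) (rawE intE)).pair (fst (rawE intE) (rawE intE)))
  have h := map (σ := List ℤ) (α := List ℤ) (β := ℤ) (eσ := rawE intE) (eα := rawE intE) (eβ := intE) hg
  have h2 := h.comp ((snd rowsE (rawE intE)).pair (fst rowsE (rawE intE)))
  exact h2.congr fun p => rfl

/-- **Columns times vector**: `(1ᵈ, cols, v) ↦ colCombL d cols v`. [folklore] -/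
theorem colCombL_codeFP : CodeFP (pairE unE (pairE rowsE (rawE intE))) (rawE intE) (fun p => colCombL p.1 p.2.1 p.2.2) := by
  -- context `(cols, v)`, item `t`
  have hg := dotZ_codeFP.comp ((colAt_codeFP.comp ((snd (pairE rowsE (rawE intE)) natE).pair (fst (pairE rowsE (rawE intE)) natE).fst')).pair
      (fst (pairE rowsE (rawE intE)) natE).snd')
  have h := map (σ := List (List ℤ) × List ℤ) (α := ℕ) (β := ℤ) (eσ := pairE rowsE (rawE intE)) (eα := natE) (eβ := intE) hg
  have h2 := h.comp ((snd unE (pairE rowsE (rawE intE))).pair (urange.comp (fst unE (pairE rowsE (rawE intE)))))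
  exact h2.congr fun p => rfl

end ListAlgebra

/-! ### The attempt programs on the code of `AttData` -/

section Att

/-- The attempt data as a tuple `(n, Brows, Gcols, Dg, N, Srows, GTcols, modM, q)`. [folklore] -/
abbrev AttTup : Type := ℕ × List (List ℤ) × List (List ℤ) × ℤ × ℕ × List (List ℤ) × List (List ℤ) × ℤ × ℕ

/-- Its code: `n` unary, matrices as `rowsE`, scalars binary. [folklore] -/
abbrev attE : AttTup → List Bool :=
  pairE unE (pairE rowsE (pairE rowsE (pairE intE (pairE natE (pairE rowsE (pairE rowsE (pairE intE natE)))))))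

/-- The tuple read as `AttData`. [folklore] -/
def toAtt (t : AttTup) : AttData := ⟨t.1, t.2.1, t.2.2.1, t.2.2.2.1, t.2.2.2.2.1, t.2.2.2.2.2.1, t.2.2.2.2.2.2.1, t.2.2.2.2.2.2.2.1, t.2.2.2.2.2.2.2.2⟩

variable {ξ : Type} (eξ : ξ → List Bool)

/-- `att_n` (bookkeeping / agreement with the specification). [folklore] -/
theorem att_n : CodeFP (pairE attE eξ) unE (fun t => (toAtt t.1).n) := (fst _ _).fst'
/-- `att_Brows` (bookkeeping / agreement with the specification). [folklore] -/
theorem att_Brows : CodeFP (pairE attE eξ) rowsE (fun t => (toAtt t.1).Brows) := (fst _ _).snd'.fst'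
/-- `att_Gcols` (bookkeeping / agreement with the specification). [folklore] -/
theorem att_Gcols : CodeFP (pairE attE eξ) rowsE (fun t => (toAtt t.1).Gcols) := (fst _ _).snd'.snd'.fst'
/-- `att_Dg` (bookkeeping / agreement with the specification). [folklore] -/
theorem att_Dg : CodeFP (pairE attE eξ) intE (fun t => (toAtt t.1).Dg) := (fst _ _).snd'.snd'.snd'.fst'
/-- `att_N` (bookkeeping / agreement with the specification). [folklore] -/
theorem att_N : CodeFP (pairE attE eξ) natE (fun t => (toAtt t.1).N) := (fst _ _).snd'.snd'.snd'.snd'.fst'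
/-- `att_Srows` (bookkeeping / agreement with the specification). [folklore] -/
theorem att_Srows : CodeFP (pairE attE eξ) rowsE (fun t => (toAtt t.1).Srows) := (fst _ _).snd'.snd'.snd'.snd'.snd'.fst'
/-- `att_GTcols` (bookkeeping / agreement with the specification). [folklore] -/
theorem att_GTcols : CodeFP (pairE attE eξ) rowsE (fun t => (toAtt t.1).GTcols) := (fst _ _).snd'.snd'.snd'.snd'.snd'.snd'.fst'
/-- `att_modM` (bookkeeping / agreement with the specification). [folklore] -/
theorem att_modM : CodeFP (pairE attE eξ) intE (fun t => (toAtt t.1).modM) := (fst _ _).snd'.snd'.snd'.snd'.snd'.snd'.snd'.fst'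
/-- `att_q` (bookkeeping / agreement with the specification). [folklore] -/
theorem att_q : CodeFP (pairE attE eξ) natE (fun t => (toAtt t.1).q) := (fst _ _).snd'.snd'.snd'.snd'.snd'.snd'.snd'.snd'
/-- `N` as an integer. [folklore] -/
theorem att_NZ : CodeFP (pairE attE eξ) intE (fun t => ((toAtt t.1).N : ℤ)) := by
  have h := intOfNat.comp (att_N eξ)
  exact h.congr fun t => rfl
/-- `N · Dg`. [folklore] -/
theorem att_NDg : CodeFP (pairE attE eξ) intE (fun t => ((toAtt t.1).N : ℤ) * (toAtt t.1).Dg) := by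
  have h := intMul.comp ((att_NZ eξ).pair (att_Dg eξ))
  exact h.congr fun t => rfl
/-- `q` as an integer. [folklore] -/
theorem att_qZ : CodeFP (pairE attE eξ) intE (fun t => ((toAtt t.1).q : ℤ)) := by
  have h := intOfNat.comp (att_q eξ)
  exact h.congr fun t => rfl

/-- `FvecL` on codes. [cite: MicciancioRegev2007, Lemma 5.7] -/
theorem FvecL_codeFP : CodeFP (pairE attE (rawE intE)) (rawE intE) (fun t => (toAtt t.1).FvecL t.2) := by
  have h := edivL_codeFP.comp ((mulVecL_codeFP.comp ((att_Brows (rawE intE)).pair (negL_codeFP.comp (snd attE (rawE intE))))).pair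
    (att_NDg (rawE intE)))
  exact h.congr fun t => rfl

/-- `yVecL` on codes. [cite: MicciancioRegev2007, Lemma 5.7] -/
theorem yVecL_codeFP : CodeFP (pairE attE (rawE intE)) (rawE intE) (fun t => (toAtt t.1).yVecL t.2) := by
  have h := negL_codeFP.comp (colCombL_codeFP.comp ((att_n (rawE intE)).pair ((att_Gcols (rawE intE)).pair FvecL_codeFP)))
  exact h.congr fun t => rfl

/-- `reduceVecL` on codes. [cite: MicciancioRegev2007, Lemma 5.7] -/
theorem reduceVecL_codeFP : CodeFP (pairE attE (rawE intE)) (rawE intE) (fun t => (toAtt t.1).reduceVecL t.2) := by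
  have hF := edivL_codeFP.comp ((mulVecL_codeFP.comp ((att_Brows (rawE intE)).pair (snd attE (rawE intE)))).pair (att_NDg (rawE intE)))
  have hG := colCombL_codeFP.comp ((att_n (rawE intE)).pair ((att_Gcols (rawE intE)).pair hF))
  have h := addL_codeFP.comp ((snd attE (rawE intE)).pair (negL_codeFP.comp (smulL_codeFP.comp ((att_NZ (rawE intE)).pair hG))))
  exact h.congr fun t => rfl

/-- `crepL` on codes. [folklore] -/
theorem crepL_codeFP : CodeFP (pairE attE (rawE intE)) (rawE intE) (fun t => (toAtt t.1).crepL t.2) := by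
  have h := reduceVecL_codeFP.comp ((fst attE (rawE intE)).pair (negL_codeFP.comp (snd attE (rawE intE))))
  exact h.congr fun t => rfl

/-- `VnumL` on codes (`(att, C, κ)`). [cite: MicciancioRegev2007, Lemma 5.8 (step 3)] -/
theorem VnumL_codeFP : CodeFP (pairE attE (pairE (rawE intE) (rawE intE))) (rawE intE) (fun t => (toAtt t.1).VnumL t.2.1 t.2.2) := by
  have hBC := mulVecL_codeFP.comp ((att_Brows (pairE (rawE intE) (rawE intE))).pair (snd attE _).fst')
  have hs := smulL_codeFP.comp ((att_NDg (pairE (rawE intE) (rawE intE))).pair (snd attE _).snd')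
  have h := colCombL_codeFP.comp ((att_n (pairE (rawE intE) (rawE intE))).pair ((att_GTcols _).pair (addL_codeFP.comp (hBC.pair hs))))
  exact h.congr fun t => rfl

/-- The residue of an integer through `a % b = a − b·(a / b)`. [folklore] -/
theorem intEMod_codeFP : CodeFP (pairE intE intE) intE (fun p => p.1 % p.2) := by
  have h := intSub.comp ((fst intE intE).pair (intMul.comp ((snd intE intE).pair intEDiv)))
  exact h.congr fun p => (Int.emod_def p.1 p.2).symm

/-- `aRowL` on codes (`(att, V)`). [cite: MicciancioRegev2007, Lemma 5.8 (step 3)] -/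
theorem aRowL_codeFP : CodeFP (pairE attE (rawE intE)) (rawE intE) (fun t => (toAtt t.1).aRowL t.2) := by
  -- context `(att, V)`, item `j`
  have hV := (rawGetOr intE).comp ((fst (pairE attE (rawE intE)) natE).snd'.pair ((snd (pairE attE (rawE intE)) natE).pair
    (const (pairE (pairE attE (rawE intE)) natE) (0 : ℤ))))
  have hq := (att_qZ (rawE intE)).comp (fst (pairE attE (rawE intE)) natE)
  have hM := (att_modM (rawE intE)).comp (fst (pairE attE (rawE intE)) natE)
  have hg := intEMod_codeFP.comp ((intEDiv.comp ((intMul.comp (hq.pair hV)).pair hM)).pair hq)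
  have h := map (σ := AttTup × List ℤ) (α := ℕ) (β := ℤ) (eσ := pairE attE (rawE intE)) (eα := natE) (eβ := intE) hg
  have h2 := h.comp ((CodeFP.id (pairE attE (rawE intE))).pair (urange.comp (att_n (rawE intE))))
  exact h2.congr fun t => rfl

/-- `cwL` on codes (`(att, κ, V)`). [cite: MicciancioRegev2007, Lemma 5.8 (ii)] -/
theorem cwL_codeFP : CodeFP (pairE attE (pairE (rawE intE) (rawE intE))) (rawE intE) (fun t => (toAtt t.1).cwL t.2.1 t.2.2) := by
  have h1 := negL_codeFP.comp (colCombL_codeFP.comp ((att_n (pairE (rawE intE) (rawE intE))).pair ((att_Gcols _).pair (snd attE _).fst')))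
  have h2 := colCombL_codeFP.comp ((att_n (pairE (rawE intE) (rawE intE))).pair ((att_Srows _).pair
    (edivL_codeFP.comp ((snd attE _).snd'.pair (att_modM _)))))
  have h := addL_codeFP.comp (h1.pair h2)
  exact h.congr fun t => rfl

/-- `VsL` on codes (`(att, Ks, κs)`). [folklore] -/
theorem VsL_codeFP : CodeFP (pairE attE (pairE rowsE rowsE)) rowsE (fun t => (toAtt t.1).VsL t.2.1 t.2.2) := by
  have hg := VnumL_codeFP.comp ((fst attE (pairE (rawE intE) (rawE intE))).pair
    ((crepL_codeFP.comp ((fst attE (pairE (rawE intE) (rawE intE))).pair (snd attE _).fst')).pair (snd attE _).snd'))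
  have hz := zipWith (σ := AttTup) (α := List ℤ) (β := List ℤ) (γ := List ℤ) (eσ := attE) (eα := rawE intE) (eβ := rawE intE)
    (eγ := rawE intE) hg
  exact hz.congr fun t => rfl

/-- `aRowsL` on codes. [cite: MicciancioRegev2007, Lemma 5.8 (step 3)] -/
theorem aRowsL_codeFP : CodeFP (pairE attE (pairE rowsE rowsE)) rowsE (fun t => (toAtt t.1).aRowsL t.2.1 t.2.2) := by
  have h := map (σ := AttTup) (α := List ℤ) (β := List ℤ) (eσ := attE) (eα := rawE intE) (eβ := rawE intE) aRowL_codeFP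
  have h2 := h.comp ((fst attE (pairE rowsE rowsE)).pair VsL_codeFP)
  exact h2.congr fun t => rfl

/-- `uVecL` on codes (`(att, Ks, κs, z)`). [cite: MicciancioRegev2007, Thm. 5.9 (step 4)] -/
theorem uVecL_codeFP : CodeFP (pairE attE (pairE rowsE (pairE rowsE (rawE intE)))) (rawE intE)
    (fun t => (toAtt t.1).uVecL t.2.1 t.2.2.1 t.2.2.2) := by
  have hA : CodeFP (pairE attE (pairE rowsE (pairE rowsE (rawE intE)))) attE (fun t => t.1) := fst _ _
  have hKs : CodeFP (pairE attE (pairE rowsE (pairE rowsE (rawE intE)))) rowsE (fun t => t.2.1) := (snd _ _).fst'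
  have hκs : CodeFP (pairE attE (pairE rowsE (pairE rowsE (rawE intE)))) rowsE (fun t => t.2.2.1) := (snd _ _).snd'.fst'
  have hz : CodeFP (pairE attE (pairE rowsE (pairE rowsE (rawE intE)))) (rawE intE) (fun t => t.2.2.2) := (snd _ _).snd'.snd'
  have hn := att_n (pairE rowsE (pairE rowsE (rawE intE)))
  have hVs := VsL_codeFP.comp (hA.pair (hKs.pair hκs))
  -- `zipWith cwL κs Vs`
  have hgc := cwL_codeFP.comp ((fst attE (pairE (rawE intE) (rawE intE))).pair ((snd attE _).fst'.pair (snd attE _).snd'))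
  have hzc := zipWith (σ := AttTup) (α := List ℤ) (β := List ℤ) (γ := List ℤ) (eσ := attE) (eα := rawE intE) (eβ := rawE intE)
    (eγ := rawE intE) hgc
  have hcws := hzc.comp (hA.pair (hκs.pair hVs))
  have h1 := colCombL_codeFP.comp (hn.pair (hcws.pair hz))
  -- `colCombL n Srows (edivL (colCombL n aRows z) q)`
  have haR := aRowsL_codeFP.comp (hA.pair (hKs.pair hκs))
  have h2 := colCombL_codeFP.comp (hn.pair ((att_Srows _).pair (edivL_codeFP.comp ((colCombL_codeFP.comp (hn.pair (haR.pair hz))).pair (att_qZ _)))))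
  -- `colCombL n (Ks.map yVecL) z`
  have hy := map (σ := AttTup) (α := List ℤ) (β := List ℤ) (eσ := attE) (eα := rawE intE) (eβ := rawE intE) yVecL_codeFP
  have hys := hy.comp (hA.pair hKs)
  have h3 := negL_codeFP.comp (colCombL_codeFP.comp (hn.pair (hys.pair hz)))
  have h := addL_codeFP.comp ((addL_codeFP.comp (h1.pair h2)).pair h3)
  exact h.congr fun t => rfl

end Att

/-! ### Generic bricks (restated to keep the import closure small) -/

section Bricks

/-- Unary multiplication (as `HidingProgramMachine.unMul_codeFP`). [folklore] -/
theorem unMulU_codeFP : CodeFP (pairE unE unE) unE (fun p => p.1 * p.2) := by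
  have h := (ulength unitE).comp (unitsMul.comp ((replicateUnit.comp (fst unE unE)).pair (replicateUnit.comp (snd unE unE))))
  exact h.congr fun p => by simp

/-- A fixed polynomial of a unary numeral, in unary (as `HidingProgramMachine.unPoly_codeFP`). [folklore] -/
theorem unPolyU_codeFP (Q : Polynomial ℕ) : CodeFP unE unE (fun n => Q.eval n) :=
  ⟨Plumb.polyFn Q, Plumb.polyFn_mem_FP Q, fun n => by rw [Plumb.polyFn_apply, length_unE, unE_eq_ones]⟩

/-- The size of a binary numeral, in unary (as `HidingProgramMachine.natSizeU_codeFP`). [folklore] -/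
theorem natSizeU'_codeFP : CodeFP natE unE Nat.size :=
  ⟨onesFn, onesFn_mem_FP, fun n => by change unE (natE n).length = unE (Nat.size n); rw [length_natE]⟩

/-- **Unary from binary under a unary bound**: `(1ᴿ, x) ↦ 1ˣ` when `x ≤ R`. [folklore] -/
theorem unOfNatLe {X : Type} {eX : X → List Bool} {r x : X → ℕ} (hr : CodeFP eX unE r) (hx : CodeFP eX natE x) (hle : ∀ a, x a ≤ r a) :
    CodeFP eX unE x :=
  (unOfNatMin.comp (hr.pair hx)).congr fun a => min_eq_left (hle a)

/-- `Nat.log 2` of a binary numeral (budget `size x > log₂ x`). [folklore] -/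
theorem natLog2_codeFP : CodeFP natE natE (Nat.log 2) := by
  have h := natLog2Min.comp ((CodeFP.id natE).pair (replicateUnit.comp natSizeU'_codeFP))
  refine h.congr fun x => ?_
  show min (List.replicate (Nat.size x) ()).length (Nat.log 2 x) = Nat.log 2 x
  rw [List.length_replicate]
  rcases Nat.eq_zero_or_pos x with rfl | hx
  · simp
  · exact min_eq_right (Nat.lt_size.2 (Nat.pow_log_le_self 2 hx.ne')).le

/-- The sign of an integer. [folklore] -/
theorem intSign_codeFP : CodeFP intE intE Int.sign := by
  have hpos : CodeFP intE bitE (fun z => decide ((0 : ℤ) < z)) := by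
    have h := intLt.comp ((const intE (0 : ℤ)).pair (CodeFP.id intE)); exact h.congr fun z => rfl
  have hneg : CodeFP intE bitE (fun z => decide (z < 0)) := by
    have h := intLt.comp ((CodeFP.id intE).pair (const intE (0 : ℤ))); exact h.congr fun z => rfl
  have h := hpos.ite (eβ := intE) (const intE (1 : ℤ)) (hneg.ite (eβ := intE) (const intE (-1 : ℤ)) (const intE (0 : ℤ)))
  refine h.congr fun z => ?_
  rcases lt_trichotomy z 0 with hz | rfl | hz
  · have h1 : ¬ (0 : ℤ) < z := not_lt.2 hz.le
    simp [h1, hz, Int.sign_eq_neg_one_of_neg hz]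
  · simp
  · have h1 : ¬ z < 0 := not_lt.2 hz.le
    simp [hz, Int.sign_eq_one_of_pos hz]

end Bricks

/-! ### The solver's input, constants and guess on codes -/

section Solver

open MRLemma510

/-- The solver's input: the instance tuple of `IncGDDInst.tupleE` and the coins. [folklore] -/
abbrev SolIn : Type := ((ℕ × List (List ℤ)) × (List (List ℤ) × ((List ℤ × ℕ) × ((ℕ × ℕ) × List Bool)))) × List Bool

/-- Its code. [folklore] -/
abbrev sinE : SolIn → List Bool := pairE IncGDDInst.tupleE strE

namespace SolIn
variable (s : SolIn)
/-- dimension -/ abbrev n : ℕ := s.1.1.1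
/-- rows of `U` -/ abbrev U : List (List ℤ) := s.1.1.2
/-- rows of `V` -/ abbrev V : List (List ℤ) := s.1.2.1
/-- target numerator -/ abbrev tw : List ℤ := s.1.2.2.1.1
/-- target denominator -/ abbrev td : ℕ := s.1.2.2.1.2
/-- radius numerator -/ abbrev rn : ℕ := s.1.2.2.2.1.1
/-- radius denominator -/ abbrev rd : ℕ := s.1.2.2.2.1.2
/-- coins -/ abbrev w : List Bool := s.2
end SolIn

/-- **The solver's constants as functions of the dimension, with their machines.** [folklore] -/
structure SolFuns where
  /-- the `SIS` modulus -/ q : ℕ → ℕ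
  /-- the number of samples -/ m : ℕ → ℕ
  /-- numerator of `β` -/ βnum : ℕ → ℕ
  /-- denominator of `β` -/ βden : ℕ → ℕ
  /-- `⌊β⌋` (or more) -/ βhat : ℕ → ℕ
  /-- base grid multiplier -/ N₀ : ℕ → ℕ
  /-- pseudo-Gaussian precision -/ mp : ℕ → ℕ
  /-- guess bits -/ Lg : ℕ → ℕ
  /-- coin-count guess bits -/ lenBits : ℕ → ℕ
  /-- box precision multiplier -/ prec : ℕ → ℕ
  /-- the oracle's coin bound -/ cb : Polynomial ℕ
  /-- a unary ruler dominating the sampler's block count `2^{2r+k}` -/ rul : ℕ → ℕ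
  q_fp : CodeFP unE natE q
  m_fp : CodeFP unE unE m
  βnum_fp : CodeFP unE natE βnum
  βden_fp : CodeFP unE natE βden
  βhat_fp : CodeFP unE natE βhat
  N₀_fp : CodeFP unE natE N₀
  mp_fp : CodeFP unE unE mp
  Lg_fp : CodeFP unE unE Lg
  lenBits_fp : CodeFP unE unE lenBits
  prec_fp : CodeFP unE natE prec
  rul_fp : CodeFP unE unE rul
  hrul : ∀ n, 2 ^ (2 * PGParams.rOf (mp n) + PGParams.kOf (mp n)) ≤ rul n

/-- The constants at dimension `n`. [folklore] -/
def SolFuns.P (F : SolFuns) (n : ℕ) : SolParams := ⟨F.q n, F.m n, F.βnum n, F.βden n, F.βhat n, F.N₀ n, F.mp n, F.Lg n, F.lenBits n, F.prec n⟩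

variable (F : SolFuns)

/-- `s_n` (bookkeeping / agreement with the specification). [folklore] -/
theorem s_n : CodeFP sinE unE SolIn.n := (fst _ _).fst'.fst'
/-- `s_nN` (bookkeeping / agreement with the specification). [folklore] -/
theorem s_nN : CodeFP sinE natE SolIn.n := by have h := natOfUn.comp s_n; exact h.congr fun s => rfl
/-- `s_U` (bookkeeping / agreement with the specification). [folklore] -/
theorem s_U : CodeFP sinE rowsE SolIn.U := (fst _ _).fst'.snd'
/-- `s_V` (bookkeeping / agreement with the specification). [folklore] -/
theorem s_V : CodeFP sinE rowsE SolIn.V := (fst _ _).snd'.fst'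
/-- `s_tw` (bookkeeping / agreement with the specification). [folklore] -/
theorem s_tw : CodeFP sinE (rawE intE) SolIn.tw := (fst _ _).snd'.snd'.fst'.fst'
/-- `s_td` (bookkeeping / agreement with the specification). [folklore] -/
theorem s_td : CodeFP sinE natE SolIn.td := (fst _ _).snd'.snd'.fst'.snd'
/-- `s_rn` (bookkeeping / agreement with the specification). [folklore] -/
theorem s_rn : CodeFP sinE natE SolIn.rn := (fst _ _).snd'.snd'.snd'.fst'.fst'
/-- `s_rd` (bookkeeping / agreement with the specification). [folklore] -/
theorem s_rd : CodeFP sinE natE SolIn.rd := (fst _ _).snd'.snd'.snd'.fst'.snd'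
/-- `s_w` (bookkeeping / agreement with the specification). [folklore] -/
theorem s_w : CodeFP sinE strE SolIn.w := snd _ _
/-- `s_q` (bookkeeping / agreement with the specification). [folklore] -/
theorem s_q : CodeFP sinE natE (fun s => (F.P s.n).q) := by have h := F.q_fp.comp s_n; exact h.congr fun s => rfl
/-- `s_m` (bookkeeping / agreement with the specification). [folklore] -/
theorem s_m : CodeFP sinE unE (fun s => (F.P s.n).m) := by have h := F.m_fp.comp s_n; exact h.congr fun s => rfl
/-- `s_mN` (bookkeeping / agreement with the specification). [folklore] -/
theorem s_mN : CodeFP sinE natE (fun s => (F.P s.n).m) := by have h := natOfUn.comp (s_m F); exact h.congr fun s => rfl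
/-- `s_βnum` (bookkeeping / agreement with the specification). [folklore] -/
theorem s_βnum : CodeFP sinE natE (fun s => (F.P s.n).βnum) := by have h := F.βnum_fp.comp s_n; exact h.congr fun s => rfl
/-- `s_βden` (bookkeeping / agreement with the specification). [folklore] -/
theorem s_βden : CodeFP sinE natE (fun s => (F.P s.n).βden) := by have h := F.βden_fp.comp s_n; exact h.congr fun s => rfl
/-- `s_βhat` (bookkeeping / agreement with the specification). [folklore] -/
theorem s_βhat : CodeFP sinE natE (fun s => (F.P s.n).βhat) := by have h := F.βhat_fp.comp s_n; exact h.congr fun s => rfl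
/-- `s_N₀` (bookkeeping / agreement with the specification). [folklore] -/
theorem s_N₀ : CodeFP sinE natE (fun s => (F.P s.n).N₀) := by have h := F.N₀_fp.comp s_n; exact h.congr fun s => rfl
/-- `s_mp` (bookkeeping / agreement with the specification). [folklore] -/
theorem s_mp : CodeFP sinE unE (fun s => (F.P s.n).mp) := by have h := F.mp_fp.comp s_n; exact h.congr fun s => rfl
/-- `s_Lg` (bookkeeping / agreement with the specification). [folklore] -/
theorem s_Lg : CodeFP sinE unE (fun s => (F.P s.n).Lg) := by have h := F.Lg_fp.comp s_n; exact h.congr fun s => rfl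
/-- `s_lenBits` (bookkeeping / agreement with the specification). [folklore] -/
theorem s_lenBits : CodeFP sinE unE (fun s => (F.P s.n).lenBits) := by have h := F.lenBits_fp.comp s_n; exact h.congr fun s => rfl
/-- `s_rul` (bookkeeping / agreement with the specification). [folklore] -/
theorem s_rul : CodeFP sinE unE (fun s => F.rul s.n) := by have h := F.rul_fp.comp s_n; exact h.congr fun s => rfl
/-- `s_prec` (bookkeeping / agreement with the specification). [folklore] -/
theorem s_prec : CodeFP sinE natE (fun s => (F.P s.n).prec) := by have h := F.prec_fp.comp s_n; exact h.congr fun s => rfl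

/-- The guess value `v = (bits of the first Lg coins) mod (m · 2β̂)`. [folklore] -/
theorem s_v : CodeFP sinE natE (fun s => bitsToNat (s.w.take (F.P s.n).Lg) % ((F.P s.n).m * (2 * (F.P s.n).βhat))) := by
  have h2 := natMul.comp ((const sinE 2).pair (s_βhat F))
  have h := natMod.comp ((strVal.comp (strTake.comp ((s_Lg F).pair s_w))).pair (natMul.comp ((s_mN F).pair h2)))
  exact h.congr fun s => rfl

/-- **The guess `(j, a)`** (`guessOf`). [cite: MicciancioRegev2007, Thm. 5.9 (step 1)] -/
theorem s_guess : CodeFP sinE (pairE natE natE) (fun s => guessOf (F.P s.n) s.w) := by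
  have h2 := natMul.comp ((const sinE 2).pair (s_βhat F))
  have h := (natDiv.comp ((s_v F).pair h2)).pair (natMod.comp ((s_v F).pair h2))
  exact h.congr fun s => rfl

/-- `alphaZ` on codes. [folklore] -/
theorem alphaZ_codeFP : CodeFP (pairE natE natE) intE (fun p => alphaZ p.1 p.2) := by
  have hc := natLt.comp ((snd natE natE).pair (fst natE natE))
  have h1 := intOfNat.comp (natAdd.comp ((snd natE natE).pair (const (pairE natE natE) 1)))
  have h2 := intNeg.comp (intOfNat.comp (natAdd.comp ((natSub.comp ((snd natE natE).pair (fst natE natE))).pair (const (pairE natE natE) 1))))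
  have h := hc.ite (eβ := intE) h1 h2
  refine h.congr fun p => ?_
  by_cases hlt : p.2 < p.1 <;> simp [alphaZ, hlt]

/-- **The guess `α` as an integer.** [folklore] -/
theorem s_α : CodeFP sinE intE (fun s => alphaZ (F.P s.n).βhat (guessOf (F.P s.n) s.w).2) := by
  have h := alphaZ_codeFP.comp ((s_βhat F).pair (s_guess F).snd')
  exact h.congr fun s => rfl

/-- The guess `j`. [folklore] -/
theorem s_j : CodeFP sinE natE (fun s => (guessOf (F.P s.n) s.w).1) := (s_guess F).fst'

/-! ### The data of the scaled instance on codes -/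

/-- `BrowsOf` on codes. [folklore] -/
theorem s_Brows : CodeFP sinE rowsE (fun s => BrowsOf s.n s.U) := by
  have h := transposeL_codeFP.comp (s_n.pair (invCols_codeFP.comp (transposeL_codeFP.comp (s_n.pair s_U))))
  exact h.congr fun s => rfl

/-- `cOf` on codes (exponent `2n − 2` in unary under the ruler `1^{2n}`). [folklore] -/
theorem s_c : CodeFP sinE intE (fun s => cOf s.n s.U) := by
  have hr : CodeFP sinE unE (fun s => s.n + s.n) := by have h := unAdd.comp (s_n.pair s_n); exact h.congr fun s => rfl
  have hx : CodeFP sinE natE (fun s => 2 * s.n - 2) := by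
    have h := natSub.comp ((natMul.comp ((const sinE 2).pair s_nN)).pair (const sinE 2)); exact h.congr fun s => rfl
  have he := unOfNatLe hr hx (fun s => by simp only [SolIn.n]; omega)
  have h := intPow.comp ((invDen_codeFP.comp s_U).pair he)
  exact h.congr fun s => rfl

/-- `DgOf` on codes. [folklore] -/
theorem s_Dg : CodeFP sinE intE (fun s => DgOf s.n s.U) := by
  have h := invDen_codeFP.comp s_Brows; exact h.congr fun s => rfl

/-- `GcolsOf` on codes. [folklore] -/
theorem s_Gcols : CodeFP sinE rowsE (fun s => GcolsOf s.n s.U) := by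
  have h := invCols_codeFP.comp s_Brows; exact h.congr fun s => rfl

/-- `SrowsOf` on codes. [folklore] -/
theorem s_Srows : CodeFP sinE rowsE (fun s => SrowsOf s.n s.U s.V) := by
  have hm := map (σ := ℤ) (α := List ℤ) (β := List ℤ) (eσ := intE) (eα := rawE intE) (eβ := rawE intE) smulL_codeFP
  have h := hm.comp (s_c.pair s_V)
  exact h.congr fun s => rfl

/-- `TSrowsOf` on codes. [folklore] -/
theorem s_TSrows : CodeFP sinE rowsE (fun s => TSrowsOf s.n s.U s.V) := by
  -- context `(Brows, Dg)`, item `s`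
  have hg := edivL_codeFP.comp ((mulVecL_codeFP.comp ((fst (pairE rowsE intE) (rawE intE)).fst'.pair (snd (pairE rowsE intE) (rawE intE)))).pair
    (fst (pairE rowsE intE) (rawE intE)).snd')
  have hm := map (σ := List (List ℤ) × ℤ) (α := List ℤ) (β := List ℤ) (eσ := pairE rowsE intE) (eα := rawE intE) (eβ := rawE intE) hg
  have h := transposeL_codeFP.comp (s_n.pair (hm.comp ((s_Brows.pair s_Dg).pair s_Srows)))
  exact h.congr fun s => rfl

/-- `dT = invDen (TSrows)` on codes. [folklore] -/
theorem s_dT : CodeFP sinE intE (fun s => invDen (TSrowsOf s.n s.U s.V)) := invDen_codeFP.comp s_TSrows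

/-- **The grid parameter `N`.** [folklore] -/
theorem s_N : CodeFP sinE natE (fun s => NOf (F.P s.n) s.td s.rd (alphaZ (F.P s.n).βhat (guessOf (F.P s.n) s.w).2)) := by
  have h := natMul.comp ((natMul.comp ((natMul.comp ((s_N₀ F).pair s_td)).pair (intNatAbs.comp (s_α F)))).pair s_rd)
  exact h.congr fun s => rfl

/-- **The box length `ℓ`** in unary. [folklore] -/
theorem s_ellU : CodeFP sinE unE (fun s => ellOf (F.P s.n).prec s.n (F.P s.n).m (invDen (TSrowsOf s.n s.U s.V))) := by
  have h := natSizeU'_codeFP.comp (natMul.comp ((natMul.comp ((natMul.comp ((natMul.comp ((s_prec F).pair s_nN)).pair (s_mN F))).pair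
    (s_mN F))).pair (intToNat.comp s_dT)))
  exact h.congr fun s => rfl

/-- The box length in binary. [folklore] -/
theorem s_ellN : CodeFP sinE natE (fun s => ellOf (F.P s.n).prec s.n (F.P s.n).m (invDen (TSrowsOf s.n s.U s.V))) := by
  have h := natOfUn.comp (s_ellU F); exact h.congr fun s => rfl

/-- The attempt data as a tuple. [folklore] -/
def attTupOf (P : SolParams) (n : ℕ) (U V : List (List ℤ)) (td rd : ℕ) (α : ℤ) : AttTup :=
  (n, BrowsOf n U, GcolsOf n U, DgOf n U, NOf P td rd α, SrowsOf n U V, invCols (TSrowsOf n U V),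
    invDen (TSrowsOf n U V) * ((NOf P td rd α : ℤ) * DgOf n U), P.q)

/-- `toAtt (attTupOf …) = attDataOfJ …`. [folklore] -/
theorem toAtt_attTupOf (P : SolParams) (n : ℕ) (U V : List (List ℤ)) (td rd : ℕ) (α : ℤ) :
    toAtt (attTupOf P n U V td rd α) = attDataOfJ P n U V td rd α := rfl

/-- **The attempt data on codes.** [folklore] -/
theorem s_att : CodeFP sinE attE (fun s => attTupOf (F.P s.n) s.n s.U s.V s.td s.rd (alphaZ (F.P s.n).βhat (guessOf (F.P s.n) s.w).2)) := by
  have hmod := intMul.comp (s_dT.pair (intMul.comp ((intOfNat.comp (s_N F)).pair s_Dg)))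
  have h := s_n.pair (s_Brows.pair (s_Gcols.pair (s_Dg.pair ((s_N F).pair (s_Srows.pair ((invCols_codeFP.comp s_TSrows).pair (hmod.pair (s_q F))))))))
  exact h.congr fun s => rfl

/-- **`X` on codes.** [folklore] -/
theorem s_X : CodeFP sinE natE (fun s => XOfJ (F.P s.n) s.n (cOf s.n s.U) s.rn s.rd (NOf (F.P s.n) s.td s.rd (alphaZ (F.P s.n).βhat (guessOf (F.P s.n) s.w).2))) := by
  have sq : ∀ {g : SolIn → ℕ}, CodeFP sinE natE g → CodeFP sinE natE (fun s => g s ^ 2) := fun hg => by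
    have h := natPow.comp (hg.pair (const sinE 2)); exact h.congr fun s => rfl
  have hnum := natMul.comp ((natMul.comp ((natMul.comp ((natMul.comp ((const sinE 80).pair (sq (intNatAbs.comp s_c)))).pair (sq s_rn))).pair
    (sq (s_N F)))).pair (sq (s_βden F)))
  have hden := natMul.comp ((natMul.comp ((natMul.comp ((const sinE 63).pair (sq (s_βnum F)))).pair s_nN)).pair (sq s_rd))
  have h := natDiv.comp (hnum.pair hden)
  exact h.congr fun s => rfl

/-- **`e` on codes** (binary). [folklore] -/
theorem s_e : CodeFP sinE natE (fun s => eOfJ (F.P s.n) s.n (cOf s.n s.U) s.rn s.rd (NOf (F.P s.n) s.td s.rd (alphaZ (F.P s.n).βhat (guessOf (F.P s.n) s.w).2))) := by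
  have h := natDiv.comp ((natLog2_codeFP.comp (s_X F)).pair (const sinE 2))
  exact h.congr fun s => rfl

/-- `e` in unary (`e ≤ log₂ X < size X`). [folklore] -/
theorem s_eU : CodeFP sinE unE (fun s => eOfJ (F.P s.n) s.n (cOf s.n s.U) s.rn s.rd (NOf (F.P s.n) s.td s.rd (alphaZ (F.P s.n).βhat (guessOf (F.P s.n) s.w).2))) := by
  refine unOfNatLe (natSizeU'_codeFP.comp (s_X F)) (s_e F) fun s => ?_
  simp only [eOfJ]
  rcases Nat.eq_zero_or_pos (XOfJ (F.P s.n) s.n (cOf s.n s.U) s.rn s.rd (NOf (F.P s.n) s.td s.rd (alphaZ (F.P s.n).βhat (guessOf (F.P s.n) s.w).2))) with hx | hx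
  · rw [hx]; simp
  · exact (Nat.div_le_self _ _).trans (Nat.lt_size.2 (Nat.pow_log_le_self 2 hx.ne')).le

/-! ### The pseudo-Gaussian record of `std mₚ e` -/

/-- `rOf m = size (m + 1)`. [folklore] -/
theorem rOf_eq_size (m : ℕ) : PGParams.rOf m = Nat.size (m + 1) := by
  rw [PGParams.rOf]
  have h1 : Nat.log 2 (m + 1) < Nat.size (m + 1) := Nat.lt_size.2 (Nat.pow_log_le_self 2 (Nat.succ_ne_zero m))
  have h2 : Nat.size (m + 1) ≤ Nat.log 2 (m + 1) + 1 := Nat.size_le.2 (Nat.lt_pow_succ_log_self (by norm_num) _)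
  omega

/-- `rOf` in unary. [folklore] -/
theorem rOfU_codeFP : CodeFP unE unE PGParams.rOf := by
  have h := natSizeU'_codeFP.comp (natOfUn.comp unSucc)
  exact h.congr fun m => (rOf_eq_size m).symm

/-- `kOf` in unary. [folklore] -/
theorem kOfU_codeFP : CodeFP unE unE PGParams.kOf := by
  have h := unAdd.comp ((unAdd.comp ((CodeFP.id unE).pair (unAdd.comp (rOfU_codeFP.pair rOfU_codeFP)))).pair (const unE 3))
  exact h.congr fun m => by show m + (PGParams.rOf m + PGParams.rOf m) + 3 = PGParams.kOf m; rw [PGParams.kOf]; ring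

/-- `2^{rOf m} ≤ 2(m+1)`. [folklore] -/
theorem two_pow_rOf_le (m : ℕ) : 2 ^ PGParams.rOf m ≤ 2 * (m + 1) := by
  rw [PGParams.rOf, pow_succ]
  have h : 2 ^ Nat.log 2 (m + 1) ≤ m + 1 := Nat.pow_log_le_self 2 (by omega)
  omega

/-- `JOf` in unary (`2^{rOf m}` under the ruler `1^{2(m+1)}`). [folklore] -/
theorem JOfU_codeFP : CodeFP unE unE PGParams.JOf := by
  have hr : CodeFP unE unE (fun m => 2 * (m + 1)) := by
    have h := unAdd.comp (unSucc.pair unSucc); exact h.congr fun m => by show m + 1 + (m + 1) = 2 * (m + 1); ring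
  have hp : CodeFP unE natE (fun m => 2 ^ PGParams.rOf m) := by
    have h := natPow.comp ((const unE 2).pair rOfU_codeFP); exact h.congr fun m => rfl
  have h2 := unOfNatLe hr hp two_pow_rOf_le
  have h := unMulU_codeFP.comp ((unMulU_codeFP.comp ((const unE 8).pair h2)).pair unSucc)
  exact h.congr fun m => rfl

/-- **The record `(std mₚ e).ctx` from `(1^{mₚ}, 1ᵉ)`** and a ruler `1ᴿ ≥ 2^{2r+k}`:
`(r+e+1, k, 2^{2r+k}, J, hdrLen + Mmax·k, 2^{r+e}, 2^k, 4^e)`. [folklore] -/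
theorem stdCtx_codeFP {X : Type} {eX : X → List Bool} {mp e R : X → ℕ} (hmp : CodeFP eX unE mp) (he : CodeFP eX unE e)
    (hR : CodeFP eX unE R) (hle : ∀ x, 2 ^ (2 * PGParams.rOf (mp x) + PGParams.kOf (mp x)) ≤ R x) :
    CodeFP eX samplerCtxE (fun x => (PGParams.std (mp x) (e x)).ctx) := by
  have hr := rOfU_codeFP.comp hmp
  have hk := kOfU_codeFP.comp hmp
  have hJ := JOfU_codeFP.comp hmp
  have hhdr := unSucc.comp (unAdd.comp (hr.pair he))
  have hMn : CodeFP eX natE (fun x => 2 ^ (2 * PGParams.rOf (mp x) + PGParams.kOf (mp x))) := by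
    have h := natPow.comp ((const eX 2).pair (unAdd.comp ((unAdd.comp (hr.pair hr)).pair hk)))
    exact h.congr fun x => by show 2 ^ (PGParams.rOf (mp x) + PGParams.rOf (mp x) + PGParams.kOf (mp x)) = _; ring_nf
  have hM := unOfNatLe hR hMn hle
  have hatt := unAdd.comp (hhdr.pair (unMulU_codeFP.comp (hM.pair hk)))
  have hT := natPow.comp ((const eX 2).pair (unAdd.comp (hr.pair he)))
  have hpk := natPow.comp ((const eX 2).pair hk)
  have hfb := natPow.comp ((const eX 4).pair he)
  have h := hhdr.pair (hk.pair (hM.pair (hJ.pair (hatt.pair (hT.pair (hpk.pair hfb))))))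
  exact h.congr fun x => rfl

/-- **The coin length `(std mₚ e).coinLen = J · attLen`** in unary. [folklore] -/
theorem stdCoinLen_codeFP {X : Type} {eX : X → List Bool} {mp e R : X → ℕ} (hmp : CodeFP eX unE mp) (he : CodeFP eX unE e)
    (hR : CodeFP eX unE R) (hle : ∀ x, 2 ^ (2 * PGParams.rOf (mp x) + PGParams.kOf (mp x)) ≤ R x) :
    CodeFP eX unE (fun x => (PGParams.std (mp x) (e x)).coinLen) := by
  have hc := stdCtx_codeFP hmp he hR hle
  have h := unMulU_codeFP.comp (hc.snd'.snd'.snd'.fst'.pair hc.snd'.snd'.snd'.snd'.fst')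
  exact h.congr fun x => rfl

/-! ### The samples and the boxes on codes -/

/-- The pseudo-Gaussian parameters of the guess, on codes. [folklore] -/
theorem s_PGctx : CodeFP sinE samplerCtxE (fun s => (PGOf (F.P s.n) s.n s.U s.td s.rn s.rd (alphaZ (F.P s.n).βhat (guessOf (F.P s.n) s.w).2)).ctx) := by
  have h := stdCtx_codeFP (s_mp F) (s_eU F) (s_rul F) (fun s => F.hrul s.n)
  exact h.congr fun s => rfl

/-- The sampler's coin length, in unary. [folklore] -/
theorem s_cl : CodeFP sinE unE (fun s => (PGOf (F.P s.n) s.n s.U s.td s.rn s.rd (alphaZ (F.P s.n).βhat (guessOf (F.P s.n) s.w).2)).coinLen) := by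
  have h := stdCoinLen_codeFP (s_mp F) (s_eU F) (s_rul F) (fun s => F.hrul s.n)
  exact h.congr fun s => rfl

/-- The coins after the guess. [folklore] -/
theorem s_w₁ : CodeFP sinE strE (fun s => s.w.drop (F.P s.n).Lg) := strDrop.comp ((s_Lg F).pair s_w)

/-- **All `n·m` samples** (`samplerVecOf`). [folklore] -/
theorem s_Xall : CodeFP sinE (rawE intE) (fun s => samplerVecOf (PGOf (F.P s.n) s.n s.U s.td s.rn s.rd (alphaZ (F.P s.n).βhat (guessOf (F.P s.n) s.w).2)).ctx
    (s.n * (F.P s.n).m) (PGOf (F.P s.n) s.n s.U s.td s.rn s.rd (alphaZ (F.P s.n).βhat (guessOf (F.P s.n) s.w).2)).coinLen (s.w.drop (F.P s.n).Lg)) := by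
  have h := samplerVecOf_codeFP.comp ((s_PGctx F).pair ((unMulU_codeFP.comp (s_n.pair (s_m F))).pair ((s_cl F).pair (s_w₁ F))))
  exact h.congr fun s => rfl

/-- Cutting a list into `m` windows of length `n`: `(1ⁿ, 1ᵐ, l) ↦ [(l.drop (i n)).take n]_{i<m}`. [folklore] -/
theorem windows_codeFP : CodeFP (pairE unE (pairE unE (rawE intE))) rowsE (fun p => (List.range p.2.1).map fun i => (p.2.2.drop (i * p.1)).take p.1) := by
  -- context `(1ⁿ, l)`, item `i`
  have hl : CodeFP (pairE (pairE unE (rawE intE)) natE) (rawE intE) (fun t => t.1.2) := (fst _ _).snd'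
  have hnU : CodeFP (pairE (pairE unE (rawE intE)) natE) unE (fun t => t.1.1) := (fst _ _).fst'
  have hin : CodeFP (pairE (pairE unE (rawE intE)) natE) natE (fun t => t.2 * t.1.1) := by
    have h := natMul.comp ((snd (pairE unE (rawE intE)) natE).pair (natOfUn.comp hnU)); exact h.congr fun t => rfl
  have hcnt := unOfNatMin.comp (((ulength intE).comp hl).pair hin)
  have hg := (rawTakeUn intE).comp (hnU.pair ((rawDropUn intE).comp (hcnt.pair hl)))
  have hm := map (σ := ℕ × List ℤ) (α := ℕ) (β := List ℤ) (eσ := pairE unE (rawE intE)) (eα := natE) (eβ := rawE intE) hg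
  have h := hm.comp (((fst unE (pairE unE (rawE intE))).pair (snd unE (pairE unE (rawE intE))).snd').pair
    (urange.comp (snd unE (pairE unE (rawE intE))).fst'))
  refine h.congr fun p => ?_
  refine List.map_congr_left fun i _ => ?_
  show (p.2.2.drop (min (i * p.1) p.2.2.length)).take p.1 = _
  rw [drop_min_length]

/-- **The sample vectors `Xs`.** [folklore] -/
theorem s_Xs : CodeFP sinE rowsE (fun s => (List.range (F.P s.n).m).map fun i =>
    ((samplerVecOf (PGOf (F.P s.n) s.n s.U s.td s.rn s.rd (alphaZ (F.P s.n).βhat (guessOf (F.P s.n) s.w).2)).ctx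
      (s.n * (F.P s.n).m) (PGOf (F.P s.n) s.n s.U s.td s.rn s.rd (alphaZ (F.P s.n).βhat (guessOf (F.P s.n) s.w).2)).coinLen (s.w.drop (F.P s.n).Lg)).drop (i * s.n)).take s.n) := by
  have h := windows_codeFP.comp (s_n.pair ((s_m F).pair (s_Xall F)))
  exact h.congr fun s => rfl

/-- The coins after the samples. [folklore] -/
theorem s_w₂ : CodeFP sinE strE (fun s => (s.w.drop (F.P s.n).Lg).drop (s.n * (F.P s.n).m *
    (PGOf (F.P s.n) s.n s.U s.td s.rn s.rd (alphaZ (F.P s.n).βhat (guessOf (F.P s.n) s.w).2)).coinLen)) := by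
  have h := strDrop.comp ((unMulU_codeFP.comp ((unMulU_codeFP.comp (s_n.pair (s_m F))).pair (s_cl F))).pair (s_w₁ F))
  exact h.congr fun s => rfl

/-- Reading boxes: `(1ⁿ, 1ᵐ, 1^ℓ, w) ↦ [[val (w[(i n + l)ℓ, +ℓ))]_{l<n}]_{i<m}`. [folklore] -/
theorem boxes_codeFP : CodeFP (pairE unE (pairE unE (pairE unE strE))) rowsE
    (fun p => (List.range p.2.1).map fun i => (List.range p.1).map fun l => (bitsToNat ((p.2.2.2.drop ((i * p.1 + l) * p.2.2.1)).take p.2.2.1) : ℤ)) := by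
  -- context `((1ⁿ, 1^ℓ, w), i)`, item `l`
  have hctx : CodeFP (pairE (pairE (pairE unE (pairE unE strE)) natE) natE) (pairE unE (pairE unE strE)) (fun t => t.1.1) := (fst _ _).fst'
  have hi : CodeFP (pairE (pairE (pairE unE (pairE unE strE)) natE) natE) natE (fun t => t.1.2) := (fst _ _).snd'
  have hl : CodeFP (pairE (pairE (pairE unE (pairE unE strE)) natE) natE) natE (fun t => t.2) := snd _ _
  have hnN := natOfUn.comp hctx.fst'
  have hellN := natOfUn.comp hctx.snd'.fst'
  have hw := hctx.snd'.snd'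
  have hk := natMul.comp ((natAdd.comp ((natMul.comp (hi.pair hnN)).pair hl)).pair hellN)
  have hcnt := unOfNatMin.comp ((strLength.comp hw).pair hk)
  have hg := intOfNat.comp (strVal.comp (strTake.comp (hctx.snd'.fst'.pair (strDrop.comp (hcnt.pair hw)))))
  have hinner := map (σ := (ℕ × ℕ × List Bool) × ℕ) (α := ℕ) (β := ℤ) (eσ := pairE (pairE unE (pairE unE strE)) natE) (eα := natE) (eβ := intE) hg
  -- middle: context `(1ⁿ, 1^ℓ, w)`, item `i`
  have hrow := hinner.comp ((CodeFP.id (pairE (pairE unE (pairE unE strE)) natE)).pair (urange.comp (fst (pairE unE (pairE unE strE)) natE).fst'))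
  have houter := map (σ := ℕ × ℕ × List Bool) (α := ℕ) (β := List ℤ) (eσ := pairE unE (pairE unE strE)) (eα := natE) (eβ := rawE intE) hrow
  have h := houter.comp (((fst unE (pairE unE (pairE unE strE))).pair (snd unE (pairE unE (pairE unE strE))).snd').pair
    (urange.comp (snd unE (pairE unE (pairE unE strE))).fst'))
  refine h.congr fun p => ?_
  refine List.map_congr_left fun i _ => List.map_congr_left fun l _ => ?_
  show ((bitsToNat ((p.2.2.2.drop (min ((i * p.1 + l) * p.2.2.1) p.2.2.2.length)).take p.2.2.1) : ℤ)) = _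
  rw [drop_min_length]

set_option maxHeartbeats 2000000 in
/-- **The box vectors `κs`.** [folklore] -/
theorem s_κs : CodeFP sinE rowsE (fun s => (List.range (F.P s.n).m).map fun i => (List.range s.n).map fun l =>
    (bitsToNat ((((s.w.drop (F.P s.n).Lg).drop (s.n * (F.P s.n).m *
      (PGOf (F.P s.n) s.n s.U s.td s.rn s.rd (alphaZ (F.P s.n).βhat (guessOf (F.P s.n) s.w).2)).coinLen)).drop
        ((i * s.n + l) * ellOf (F.P s.n).prec s.n (F.P s.n).m (invDen (TSrowsOf s.n s.U s.V)))).take (ellOf (F.P s.n).prec s.n (F.P s.n).m (invDen (TSrowsOf s.n s.U s.V)))) : ℤ)) := by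
  have h := boxes_codeFP.comp (s_n.pair ((s_m F).pair ((s_ellU F).pair (s_w₂ F))))
  exact h.congr fun s => rfl

/-! ### The shifts, the query, the oracle call, the answer and the core on codes -/

/-- **The shift rows** `TshRow` (item `i`). [cite: MicciancioRegev2007, Thm. 5.9 (step 1)] -/
theorem s_Tsh : CodeFP (pairE sinE natE) (rawE intE) (fun t => TshRow (F.P t.1.n) t.1.n (cOf t.1.n t.1.U) t.1.tw t.1.rd
    (alphaZ (F.P t.1.n).βhat (guessOf (F.P t.1.n) t.1.w).2) (guessOf (F.P t.1.n) t.1.w).1 t.2) := by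
  have hs : CodeFP (pairE sinE natE) sinE (fun t => t.1) := fst _ _
  have hi : CodeFP (pairE sinE natE) natE (fun t => t.2) := snd _ _
  have hc := natEq.comp (hi.pair ((s_j F).comp hs))
  have hK := intMul.comp ((intNeg.comp (intMul.comp ((intMul.comp ((intOfNat.comp ((s_N₀ F).comp hs)).pair (intSign_codeFP.comp ((s_α F).comp hs)))).pair
    (intOfNat.comp (s_rd.comp hs))))).pair (s_c.comp hs))
  have h1 := smulL_codeFP.comp (hK.pair (s_tw.comp hs))
  have h0 := (replicateOf intE).comp ((const (pairE sinE natE) (0 : ℤ)).pair (s_n.comp hs))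
  have h := hc.ite (eβ := rawE intE) h1 h0
  refine h.congr fun t => ?_
  simp only [TshRow]
  by_cases hij : t.2 = (guessOf (F.P t.1.n) t.1.w).1 <;> simp [hij]

/-- **The shifted noises `Ks`.** [folklore] -/
theorem s_Ks : CodeFP sinE rowsE (fun s => (List.range (F.P s.n).m).map fun i =>
    addL (((List.range (F.P s.n).m).map fun i =>
      ((samplerVecOf (PGOf (F.P s.n) s.n s.U s.td s.rn s.rd (alphaZ (F.P s.n).βhat (guessOf (F.P s.n) s.w).2)).ctx
        (s.n * (F.P s.n).m) (PGOf (F.P s.n) s.n s.U s.td s.rn s.rd (alphaZ (F.P s.n).βhat (guessOf (F.P s.n) s.w).2)).coinLen (s.w.drop (F.P s.n).Lg)).drop (i * s.n)).take s.n).getD i [])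
      (TshRow (F.P s.n) s.n (cOf s.n s.U) s.tw s.rd (alphaZ (F.P s.n).βhat (guessOf (F.P s.n) s.w).2) (guessOf (F.P s.n) s.w).1 i)) := by
  have hs : CodeFP (pairE sinE natE) sinE (fun t => t.1) := fst _ _
  have hi : CodeFP (pairE sinE natE) natE (fun t => t.2) := snd _ _
  have hget := (rawGetOr (rawE intE)).comp (((s_Xs F).comp hs).pair (hi.pair (const (pairE sinE natE) ([] : List ℤ))))
  have hg := addL_codeFP.comp (hget.pair (s_Tsh F))
  have hm := map (σ := SolIn) (α := ℕ) (β := List ℤ) (eσ := sinE) (eα := natE) (eβ := rawE intE) hg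
  have h := hm.comp ((CodeFP.id sinE).pair (urange.comp (s_m F)))
  exact h.congr fun s => rfl

/-- `valRows` on codes: `(1ⁿ, 1ᵐ, rows) ↦ [[rows[j'][i].toNat]_{j'<m}]_{i<n}`. [folklore] -/
theorem valRows_codeFP : CodeFP (pairE unE (pairE unE rowsE)) (rawE (rawE natE)) (fun p => valRows p.1 p.2.1 p.2.2) := by
  -- context `(rows, i)`, item `j'`
  have hrow := (rawGetOr (rawE intE)).comp ((fst (pairE rowsE natE) natE).fst'.pair ((snd (pairE rowsE natE) natE).pair
    (const (pairE (pairE rowsE natE) natE) ([] : List ℤ))))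
  have hent := (rawGetOr intE).comp (hrow.pair ((fst (pairE rowsE natE) natE).snd'.pair (const (pairE (pairE rowsE natE) natE) (0 : ℤ))))
  have hg := intToNat.comp hent
  have hinner := map (σ := List (List ℤ) × ℕ) (α := ℕ) (β := ℕ) (eσ := pairE rowsE natE) (eα := natE) (eβ := natE) hg
  -- middle: context `(1ᵐ, rows)`, item `i`
  have hmid := hinner.comp ((((fst (pairE unE rowsE) natE).snd'.pair (snd (pairE unE rowsE) natE))).pair
    (urange.comp (fst (pairE unE rowsE) natE).fst'))
  have houter := map (σ := ℕ × List (List ℤ)) (α := ℕ) (β := List ℕ) (eσ := pairE unE rowsE) (eα := natE) (eβ := rawE natE) hmid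
  have h := houter.comp ((snd unE (pairE unE rowsE)).pair (urange.comp (fst unE (pairE unE rowsE))))
  exact h.congr fun p => rfl

/-- **The query string** `queryStr` on codes. [cite: MicciancioRegev2007, Def. 5.3] -/
theorem queryStr_codeFP : CodeFP (pairE unE (pairE unE (pairE natE rowsE))) strE (fun p => queryStr p.1 p.2.1 p.2.2.1 p.2.2.2) := by
  have hn := natOfUn.comp (fst unE (pairE unE (pairE natE rowsE)))
  have hm := natOfUn.comp (snd unE (pairE unE (pairE natE rowsE))).fst'
  have hq := (snd unE (pairE unE (pairE natE rowsE))).snd'.fst'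
  have hv := valRows_codeFP.comp ((fst unE _).pair ((snd unE (pairE unE (pairE natE rowsE))).fst'.pair (snd unE _).snd'.snd'))
  have hl := (listOfRaw (listE natE)).comp ((map₀ (eα := rawE natE) (eβ := listE natE) (listOfRaw natE)).comp hv)
  have h := hn.pair (hm.pair (hq.pair hl))
  exact recodeOut (eγ := strE) h fun p => by simp [queryStr]

/-- **The query of the solver.** [folklore] -/
theorem s_qs : CodeFP sinE strE (fun s => queryStr s.n (F.P s.n).m (F.P s.n).q
    ((attDataOfJ (F.P s.n) s.n s.U s.V s.td s.rd (alphaZ (F.P s.n).βhat (guessOf (F.P s.n) s.w).2)).aRowsL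
      ((List.range (F.P s.n).m).map fun i =>
        addL (((List.range (F.P s.n).m).map fun i =>
          ((samplerVecOf (PGOf (F.P s.n) s.n s.U s.td s.rn s.rd (alphaZ (F.P s.n).βhat (guessOf (F.P s.n) s.w).2)).ctx
            (s.n * (F.P s.n).m) (PGOf (F.P s.n) s.n s.U s.td s.rn s.rd (alphaZ (F.P s.n).βhat (guessOf (F.P s.n) s.w).2)).coinLen (s.w.drop (F.P s.n).Lg)).drop (i * s.n)).take s.n).getD i [])
          (TshRow (F.P s.n) s.n (cOf s.n s.U) s.tw s.rd (alphaZ (F.P s.n).βhat (guessOf (F.P s.n) s.w).2) (guessOf (F.P s.n) s.w).1 i))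
      ((List.range (F.P s.n).m).map fun i => (List.range s.n).map fun l =>
        (bitsToNat ((((s.w.drop (F.P s.n).Lg).drop (s.n * (F.P s.n).m *
          (PGOf (F.P s.n) s.n s.U s.td s.rn s.rd (alphaZ (F.P s.n).βhat (guessOf (F.P s.n) s.w).2)).coinLen)).drop
            ((i * s.n + l) * ellOf (F.P s.n).prec s.n (F.P s.n).m (invDen (TSrowsOf s.n s.U s.V)))).take (ellOf (F.P s.n).prec s.n (F.P s.n).m (invDen (TSrowsOf s.n s.U s.V)))) : ℤ)))) := by
  have ha := aRowsL_codeFP.comp ((s_att F).pair ((s_Ks F).pair (s_κs F)))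
  have h := queryStr_codeFP.comp (s_n.pair ((s_m F).pair ((s_q F).pair ha)))
  exact h.congr fun s => rfl

/-- **Reading the oracle's answer** `readAns` on codes (dimension in unary), as `RegevGIVPPost.readVec_codeFP`.
[cite: AroraBarak2009, §0.1] -/
theorem readAns_codeFP : CodeFP (pairE unE strE) (rawE intE) (fun p => readAns p.1 p.2) := by
  have pn : CodeFP (pairE unE strE) unE (fun p => p.1) := fst _ _
  have pnN : CodeFP (pairE unE strE) natE (fun p => p.1) := by have h := natOfUn.comp pn; exact h.congr fun _ => rfl
  have hcanon : CodeFP strE (pairE natE (listE smE)) (fun u => (SIS.OddPartFP.hdrOf u, SIS.OddPartFP.entriesOf (SIS.OddPartFP.lenOf u) u)) :=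
    ⟨SIS.OddPartFP.canonIV, SIS.OddPartFP.canonIV_mem_FP, fun u => by
      dsimp only
      rw [SIS.OddPartFP.canonIV_apply, pairE_apply, listE, length_entriesOf']
      rfl⟩
  have hc := hcanon.comp (snd unE strE)
  have hhdr := hc.fst'
  have hes : CodeFP (pairE unE strE) (rawE intE) (fun p => SIS.OddPartFP.entriesOf (SIS.OddPartFP.lenOf p.2) p.2) := by
    have h := ((map₀ (eα := smE) (eβ := intE) intOfSM).comp (rawOfList smE)).comp hc.snd'
    exact h.congr fun p => by simp
  have hlen := (natLength intE).comp hes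
  have hcond : CodeFP (pairE unE strE) bitE (fun p => decide (SIS.OddPartFP.hdrOf p.2 = p.1) &&
      decide ((SIS.OddPartFP.entriesOf (SIS.OddPartFP.lenOf p.2) p.2).length = p.1)) := by
    have h := (natEq.comp (hhdr.pair pnN)).and (natEq.comp (hlen.pair pnN)); exact h.congr fun _ => rfl
  have hzero : CodeFP (pairE unE strE) (rawE intE) (fun p => List.replicate p.1 (0 : ℤ)) := by
    have h := (replicateOf intE).comp ((const (pairE unE strE) (0 : ℤ)).pair pn); exact h.congr fun _ => rfl
  refine (hcond.ite (eβ := rawE intE) hes hzero).congr fun p => ?_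
  rw [readAns, length_entriesOf']
  by_cases h : SIS.OddPartFP.hdrOf p.2 = p.1 ∧ SIS.OddPartFP.lenOf p.2 = p.1
  · rw [if_pos h, if_pos (by simp [h.1, h.2]), h.2]
  · rw [if_neg h, if_neg (by simpa [Bool.and_eq_true, decide_eq_true_iff] using h)]

/-- `answerRow` on codes. [cite: Cohen1993, §2.6.3] -/
theorem answerRow_codeFP : CodeFP (pairE sinE (rawE intE)) (rawE intE) (fun t => answerRow t.1.n t.1.U t.2) := by
  have hs : CodeFP (pairE sinE (rawE intE)) sinE (fun t => t.1) := fst _ _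
  have hn := s_n.comp hs
  have hU := s_U.comp hs
  have h := edivL_codeFP.comp ((colCombL_codeFP.comp (hn.pair ((transposeL_codeFP.comp (hn.pair (invCols_codeFP.comp hU))).pair (snd sinE (rawE intE))))).pair
    (intMul.comp ((s_c.comp hs).pair (invDen_codeFP.comp hU))))
  exact h.congr fun t => rfl

set_option maxHeartbeats 4000000 in
/-- **The solver is typed polynomial time** against a typed-polynomial-time oracle.
[cite: MicciancioRegev2007, Thm. 5.9 ("there is a probabilistic polynomial-time oracle algorithm")] -/
theorem solRun_codeFP {orun : List Bool → List Bool → List Bool} (horun : CodeFP (pairE strE strE) strE (fun p => orun p.1 p.2)) :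
    CodeFP sinE strE (fun s => solRun (F.P s.n) orun (fun L => F.cb.eval L) s.n s.U s.V s.tw s.td s.rn s.rd s.w) := by
  -- the coins after the boxes
  have hw₃ := strDrop.comp ((unMulU_codeFP.comp ((unMulU_codeFP.comp (s_n.pair (s_m F))).pair (s_ellU F))).pair (s_w₂ F))
  -- the oracle's coin count guessed, the oracle's coins and its answer
  have hbudU := unSucc.comp ((unPolyU_codeFP F.cb).comp (strLength.comp (s_qs F)))
  have hbudN := natOfUn.comp hbudU
  have hLoN := natMod.comp ((strVal.comp (strTake.comp ((s_lenBits F).pair hw₃))).pair hbudN)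
  have hLo := unOfNatLe hbudU hLoN (fun s => (Nat.mod_lt _ (Nat.succ_pos _)).le)
  have hcoins := strTake.comp (hLo.pair (strDrop.comp ((s_lenBits F).pair hw₃)))
  have hans := horun.comp ((s_qs F).pair hcoins)
  have hz := readAns_codeFP.comp ((s_m F).pair hans)
  -- the core and the answer row
  have hu := uVecL_codeFP.comp ((s_att F).pair ((s_Ks F).pair ((s_κs F).pair hz)))
  have hrow := answerRow_codeFP.comp ((CodeFP.id sinE).pair hu)
  refine recodeOut (eγ := strE) hrow fun s => ?_
  rfl

end Solver

end DualGrid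

end Literature.Algebra.EuclideanLattices

end
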